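import Summits.ValiantsHypothesis.ValiantsHypothesis.Theorems.BarrierLeverAnchoredDoorHitsLowerPairsStarOrdered

/-!
# Route BarrierLever — support item `AnchoredDoorHitsLowerPairs` (stmt-ValiantsHypothesis-22510), line `anchored_peeling`:
# NODE TEXT «MASS-MERGE ORDER» — an explicit linear order of the vertices conjectured to make the ordered star door nonsingular

Node file (`--supports stmt-ValiantsHypothesis-22510`; val-np-p1 g36). Closes NO item; nothing here bears on crux 14610 or on `VP ≠ VNP`, which is
NOT proved; `Stmt.conjStarLower` / `Stmt.conjStarOrdered` are NOT proved here.

THE RULE (memo HOME/val-np-p1/g36/MEMO-valnp1-g36.md §6). MASS of a vertex = number of faces through it other than the vertex itself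
(`rowMass u b = #{i : b ∈ u i} − 1`). Sort each side by increasing mass (ties by label); CUMULATIVE MASS `rowCum u b` = total mass of the row
vertices up to and including `b` in that sorted order; merge the two sides by cumulative mass FRACTION (cross-multiplied: the row vertex `b`
precedes the column vertex `e` iff `rowCum u b · colTotal' w ≤ colCum w e · rowTotal' u`, totals floored at 1). Positions `mmRowPos`, `mmColPos`
encode exactly this comparison, so `StarDoor.IsOrdered (mmRowPos u w) (mmColPos u w) g d` says: every leaf hangs on a centre that is EARLIER in the
mass-merge order. Poor vertices come first (they are centres), rich vertices last (they are leaves); the two sides advance at the same rate of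
incidence mass; a side of isolated points comes entirely first (= the evaluation door `E`).

THE NODE `Stmt.conjStarMassMerge`: for every injective lower pair, SOME weights ordered for the mass-merge positions give a nonsingular star block.
Arrow `conjStarOrdered_of_conjStarMassMerge` (hence ⇒ `conjStarLower` ⇒ the item). CENSUS (numerics mod 2³¹−1, two draws; lab exp23/exp24 + kit
j338364, evidence on 22510; kit j338406 extends it): ZERO failures on all 1 975 canonical lower pairs on ≤ 5+5 vertices, on 370 random lower pairs on
4+7 … 7+7 vertices, and on the named pairs `(K_{1,4m−2} ⊔ K₂, m·C₄)` (m = 2..5, r ≤ 41), `(Q₃, K₆ − e)`, `(K₅, C₇ + chord)`, `(∂Δⁿ, Δⁿ⁻¹ ⊔ Δⁿ⁻¹)`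
(n = 3,4,5, r ≤ 63), `(2^[k], points)` (k = 3,4,5), `(2^[4], B(5,2))`, `(2^[6], B(7,3))` (r = 64), `(∂Δ³, K₅ − e)`, `(Δ⁵⁽²⁾, G(9,32))` — for BOTH
tie-break parities; the same holds for the unnormalised variant (merge by absolute cumulative mass) and for mass' = Σ_{S ∋ v} (|S| − 1); the variants
«mass = #faces through v» and «mass = #facets through v» FAIL on cubes vs points, «mass²» fails on the rigid family (memo §6). WHY IT MIGHT FAIL: one
injective lower pair on which the mass-merge ordered specialisation is singular for all weights — a finite computation per pair; none known.
-/

set_option linter.dupNamespace false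

namespace Summit.ValiantsHypothesis.ValiantsHypothesis.Theorems.BarrierLever.AnchoredPeeling

open Finset

noncomputable section

namespace StarDoor

variable {h r : ℕ}

/-- Mass of the row vertex `b`: the number of faces through `b` other than `{b}` (`= #{i : b ∈ u i} − 1`, truncated). -/
def rowMass (u : Fin r → Finset (Fin h)) (b : Fin h) : ℕ := (univ.filter fun i => b ∈ u i).card - 1

/-- The within-side sort key: by mass, ties by label. `rowLE u b' b` = «`b'` is sorted no later than `b`». -/
abbrev rowLE (u : Fin r → Finset (Fin h)) (b' b : Fin h) : Prop := rowMass u b' < rowMass u b ∨ (rowMass u b' = rowMass u b ∧ b' ≤ b)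

/-- Cumulative mass of the row side up to and including `b` (in the mass-sorted order). -/
def rowCum (u : Fin r → Finset (Fin h)) (b : Fin h) : ℕ := ∑ b' ∈ univ.filter (fun b' => rowLE u b' b), rowMass u b'

/-- Total row mass, floored at `1`. -/
def rowTotal' (u : Fin r → Finset (Fin h)) : ℕ := max 1 (∑ b, rowMass u b)

/-- **Mass-merge positions.** Row vertex `b` sits at `2 · rowCum u b · colTotal' w`, column vertex `e` at `2 · colCum w e · rowTotal' u + 1`; hence
`e` is EARLIER than `b` iff `colCum w e · rowTotal' u < rowCum u b · colTotal' w` (column cumulative fraction strictly smaller), and `b` is earlier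
than `e` iff `rowCum u b · colTotal' w ≤ colCum w e · rowTotal' u` (ties: the row vertex first). Column-side quantities are the row-side ones of `w`. -/
def mmRowPos (u w : Fin r → Finset (Fin h)) (b : Fin h) : ℕ := 2 * rowCum u b * rowTotal' w

/-- Mass-merge position of the column vertex `e`: `2 · colCum · rowTotal' + 1` (odd; see `mmRowPos`). -/
def mmColPos (u w : Fin r → Finset (Fin h)) (e : Fin h) : ℕ := 2 * rowCum w e * rowTotal' u + 1

/-- The two position functions never tie across the sides (even vs odd). -/
theorem mmRowPos_ne_mmColPos (u w : Fin r → Finset (Fin h)) (b e : Fin h) : mmRowPos u w b ≠ mmColPos u w e := by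
  unfold mmRowPos mmColPos
  intro hEq
  have h2 : 2 ∣ 2 * rowCum w e * rowTotal' u + 1 := by
    rw [← hEq, mul_assoc]
    exact dvd_mul_right 2 _
  rw [mul_assoc] at h2
  omega

end StarDoor

/-- **NODE TEXT (val-np-p1 g36): THE MASS-MERGE ORDER WORKS.** For all `h`, `r` and every pair of injective enumerations `u`, `w` of LOWER families
of faces of the same size there are complex weights `g d`, ORDERED for the mass-merge positions (`StarDoor.IsOrdered (mmRowPos u w) (mmColPos u w)`:
a row vertex hangs only on column centres of strictly smaller cumulative-mass fraction, a column vertex only on row centres of smaller-or-equal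
fraction), with nonsingular star-forest block. Implies `Stmt.conjStarOrdered` (`conjStarOrdered_of_conjStarMassMerge`). WHY IT MIGHT FAIL: one lower
pair whose mass-merge ordered specialisation is singular (none among ≈ 2 400 pairs tested, incl. every pair on ≤ 5+5 vertices; kit j338364/j338406). -/
def Stmt.conjStarMassMerge : Prop :=
  ∀ (h r : ℕ) (u w : Fin r → Finset (Fin h)), Function.Injective u → Function.Injective w →
    IsLowerSet (Set.range u) → IsLowerSet (Set.range w) →
    ∃ g d : Fin h → Fin h → ℂ, StarDoor.IsOrdered (StarDoor.mmRowPos u w) (StarDoor.mmColPos u w) g d ∧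
      (Matrix.of fun i j : Fin r => StarDoor.starEntry g d (u i) (w j)).det ≠ 0

/-- MASS-MERGE ⟹ ORDERED STAR-LOWER (the mass-merge positions are an admissible order). -/
theorem conjStarOrdered_of_conjStarMassMerge (H : Stmt.conjStarMassMerge) : Stmt.conjStarOrdered := by
  intro h r u w hu hw hlu hlw
  obtain ⟨g, d, ho, hdet⟩ := H h r u w hu hw hlu hlw
  exact ⟨_, _, g, d, ho, hdet⟩

/-- **COMPOSITION BY NAME: `Stmt.conjStarMassMerge → AnchoredDoorHitsLowerPairs`.** -/
theorem anchoredDoorHitsLowerPairs_of_conjStarMassMerge (H : Stmt.conjStarMassMerge) :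
    Summit.ValiantsHypothesis.ValiantsHypothesis.Theses.BarrierLever.AnchoredDoorHitsLowerPairs :=
  anchoredDoorHitsLowerPairs_of_conjStarOrdered (conjStarOrdered_of_conjStarMassMerge H)

end

end Summit.ValiantsHypothesis.ValiantsHypothesis.Theorems.BarrierLever.AnchoredPeeling
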